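import Summits.BirchSwinnertonDyer.BirchSwinnertonDyer.Theorems.PrintX11aUpperNonSurjFiveExcFlatCores
import HarnessLib

/-!
# Route `PrintX11a`, crux U5 = `Theses.PrintX11a.UpperNonSurjFive` (item stmt-BirchSwinnertonDyer-20614), line of record «gl1cartan5» (REV 12):
# the open part of U5 is TWO cores, uniform in the reduction type of `p` — «`Ш(E)[p] ≠ 0`» and «`Ш(E)[p] = 0 ∧ ord_p ∏c ≥ 2`»

Cell `bsd-print-x11a`, LEAD `cruxlead-stmt-BirchSwinnertonDyer-20614` g7 (`--supports stmt-BirchSwinnertonDyer-20614 --as helper`).  THEOREMS ONLY (no definition, no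
named fact minted, no `sorry`); sequel of `Theorems/PrintX11aUpperNonSurjFiveExcFlatCores.lean` (g6, p688981).  REV 11 of the line left three FLAT cores open:
C_exc♭ «`p` split ∧ (`Ш(E)[p] ≠ 0` ∨ `ord_p ∏c ≥ 2`)», C_exp «`p` non-split ∧ `Ш(E)[p] ≠ 0` ∧ `L(E,1)/Ω_E` non-unit», C_tam «`p` non-split ∧ `ord_p ∏c ≥ 2` ∧
`Ш(E)[p] = 0` ∧ `L(E,1)/Ω_E` non-unit».  REV 12 re-cuts them along the two terms of the BSD quotient they concern, dropping the reduction type of `p` and the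
non-unit clauses (both are absorbed by the CLOSED unit sector):

* the EXPONENT core C_Ш «X11a ∧ ¬Surj ∧ `5 ≤ p` ∧ `Ш(E)[p] ≠ 0` ⟹ `MissingUpperBoundAt`» — an Euler-system bound of exponent `≥ 1` at residual image
  `5Ns`/`5S4`/`7Ns` (order prime to `p`: no element `τ` with `T/(τ − 1)T` free of rank one, since `det τ = 1` and one eigenvalue `1` force `τ` unipotent);
* the DEEP-TAMAGAWA core C_cc «X11a ∧ ¬Surj ∧ `5 ≤ p` ∧ `Ш(E)[p] = 0` ∧ `ord_p ∏_ℓ c_ℓ ≥ 2` ⟹ `MissingUpperBoundAt`» — «two Tamagawa `p`'s ⟹ `p² ∣ L(E,1)/Ω_E`».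
  Its two strata behave differently: (T1) ONE split multiplicative prime `ℓ` with `p² ∣ c_ℓ = v_ℓ(Δ)` — a level-lowering congruence modulo `p²` would pay it
  (`ρ_{E,p²}` is unramified at `ℓ`; not in print at `p ∥ N`); (T2) TWO split multiplicative primes `ℓ₁ ≠ ℓ₂` with `p ∥ c_{ℓ_i}` — NO congruence of `f_E` with a
  single eigenform pays it (a congruence modulo `𝔭^n` needs `p^n ∣ c_{ℓ_i}` and yields `ord_p ≥ max nᵢ`, BSD asks `Σ nᵢ`): T2 needs a mechanism multiplicative over
  the primes (the control theorem of an Iwasawa main conjecture, or an exact degree formula of Ribet–Takahashi type coupled with a unit twisted value), i.e. it sits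
  on the SAME wall as C_Ш.  Both known depth-two census pairs (118080ds1: split at 5 and 41; 346560lh1: split at 3 and 5; `N < 5·10⁵`) are T2.

This file (all fact-free except the turnkey):
* §1 `exponentCore_of_unitSector_of_flatCores`, `deepTamagawaCore_of_unitSector_of_flatCores` — UNIT ∧ C_exc♭ ∧ C_exp ⟹ C_Ш and UNIT ∧ C_exc♭ ∧ C_tam ⟹ C_cc
  (case split on the type of `p`, then on «`L(E,1)/Ω_E` a `p`-adic unit», served by the unit sector); `threeFlatCores_of_twoCores` — the converse weakening.
  So rev 12 asks NO MORE of the future than rev 11 (modulo the closed unit sector) and no less.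
* §2 `upperNonSurjFive_of_sectors_of_twoCores` — glue BY NAME: UNIT → SHALLOW → EXC-SHALLOW → C_Ш → C_cc ⟹ U5; `upperNonSurjFive_of_elevenFacts_of_twoCores` —
  PLANNER TURNKEY (the eleven named facts + the two cores ⟹ U5); `upperNonSurjFive_iff_sectors_and_twoCores` — exactness.

HONEST FRAMING: every positive statement is CONDITIONAL on the displayed named facts and on the two OPEN cores, which are U5 verbatim on sub-loci; after rev 12 the
open part of U5 is exactly «`Ш(E)[p] ≠ 0`» ⊔ «`Ш(E)[p] = 0` ∧ `ord_p ∏c ≥ 2`».  BSD is not proved by any of this; no statement of the summit is proved here; nothing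
bounds a non-trivial `Ш`. [cite: Miller2011LMS, Def. 1.1 (arXiv:1010.2431 p. 3)] [cite: Kato2004Asterisque, §17.13 (pp. 279–280)]
[cite: Rubin2000EulerSystems, Thm. 2.2.10 and §2.1 Hyp(K,T)] [cite: RibetLevelLowering1990, Thm. 1.1]
-/

set_option linter.dupNamespace false
set_option autoImplicit false

noncomputable section

open scoped Classical

open WeierstrassCurve
  Literature.NumberTheory.EllipticCurves
  Literature.NumberTheory.EllipticCurves.ModularForms
  Literature.NumberTheory.EllipticCurves.Rank1Residual
  Literature.NumberTheory.EllipticCurves.Rank1Residual.Typed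
  Literature.NumberTheory.EllipticCurves.SteinWuthrich2013
  Literature.NumberTheory.EllipticCurves.Kato2004
  Summit.BirchSwinnertonDyer.Rank1Residual
  Summit.BirchSwinnertonDyer.BirchSwinnertonDyer.Theses

namespace Summit.BirchSwinnertonDyer.BirchSwinnertonDyer.Theorems.GL1Cartan

/-! ## §1 The two uniform cores versus the three flat cores of rev 11 (fact-free, modulo the unit-sector statement) -/

/-- **UNIT ∧ C_exc♭ ∧ C_exp ⟹ C_Ш (fact-free).**  At a pair with `Ш(E)[p] ≠ 0`: if `p` is split multiplicative, C_exc♭ (first clause); if `p` is non-split and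
`L(E,1)/Ω_E` is a `p`-adic unit, the unit sector; otherwise C_exp. [cite: Miller2011LMS, Def. 1.1 (arXiv:1010.2431 p. 3)] -/
theorem exponentCore_of_unitSector_of_flatCores
    (hU : ∀ (W : WeierstrassCurve ℚ) [W.IsElliptic] [W.IsGloballyMinimal] (p : ℕ) [Fact p.Prime],
      ClassX11a W p → ¬ Surj W p → 5 ≤ p → ¬ W.HasSplitMultiplicativeReductionAtPrime p →
      (∃ t : ℚ, W.entireLFunction 1 / (W.realPeriodRat : ℂ) = (t : ℂ) ∧ padicValRat p t = 0) →
      MissingUpperBoundAt W p)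
    (hCe : ∀ (W : WeierstrassCurve ℚ) [W.IsElliptic] [W.IsGloballyMinimal] (p : ℕ) [Fact p.Prime],
      ClassX11a W p → ¬ Surj W p → 5 ≤ p → W.HasSplitMultiplicativeReductionAtPrime p →
      ((∃ x : W.sha, (p : ℤ) • x = 0 ∧ x ≠ 0) ∨ 2 ≤ padicValNat p W.tamagawaProduct) → MissingUpperBoundAt W p)
    (hCx : ∀ (W : WeierstrassCurve ℚ) [W.IsElliptic] [W.IsGloballyMinimal] (p : ℕ) [Fact p.Prime],
      ClassX11a W p → ¬ Surj W p → 5 ≤ p → ¬ W.HasSplitMultiplicativeReductionAtPrime p →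
      (∃ x : W.sha, (p : ℤ) • x = 0 ∧ x ≠ 0) →
      (∀ t : ℚ, W.entireLFunction 1 / (W.realPeriodRat : ℂ) = (t : ℂ) → padicValRat p t ≠ 0) →
      MissingUpperBoundAt W p) :
    ∀ (W : WeierstrassCurve ℚ) [W.IsElliptic] [W.IsGloballyMinimal] (p : ℕ) [Fact p.Prime],
      ClassX11a W p → ¬ Surj W p → 5 ≤ p → (∃ x : W.sha, (p : ℤ) • x = 0 ∧ x ≠ 0) → MissingUpperBoundAt W p := by
  intro W _ _ p _ hX hns hp5 hSha
  by_cases hsp : W.HasSplitMultiplicativeReductionAtPrime p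
  · exact hCe W p hX hns hp5 hsp (Or.inl hSha)
  by_cases hunit : ∃ t : ℚ, W.entireLFunction 1 / (W.realPeriodRat : ℂ) = (t : ℂ) ∧ padicValRat p t = 0
  · exact hU W p hX hns hp5 hsp hunit
  · exact hCx W p hX hns hp5 hsp hSha fun t ht h0 => hunit ⟨t, ht, h0⟩

/-- **UNIT ∧ C_exc♭ ∧ C_tam ⟹ C_cc (fact-free).**  At a pair with `Ш(E)[p] = 0` and `ord_p ∏c ≥ 2`: if `p` is split multiplicative, C_exc♭ (second clause); if `p` is
non-split and `L(E,1)/Ω_E` is a `p`-adic unit, the unit sector; otherwise C_tam. [cite: Miller2011LMS, Def. 1.1 (arXiv:1010.2431 p. 3)] -/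
theorem deepTamagawaCore_of_unitSector_of_flatCores
    (hU : ∀ (W : WeierstrassCurve ℚ) [W.IsElliptic] [W.IsGloballyMinimal] (p : ℕ) [Fact p.Prime],
      ClassX11a W p → ¬ Surj W p → 5 ≤ p → ¬ W.HasSplitMultiplicativeReductionAtPrime p →
      (∃ t : ℚ, W.entireLFunction 1 / (W.realPeriodRat : ℂ) = (t : ℂ) ∧ padicValRat p t = 0) →
      MissingUpperBoundAt W p)
    (hCe : ∀ (W : WeierstrassCurve ℚ) [W.IsElliptic] [W.IsGloballyMinimal] (p : ℕ) [Fact p.Prime],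
      ClassX11a W p → ¬ Surj W p → 5 ≤ p → W.HasSplitMultiplicativeReductionAtPrime p →
      ((∃ x : W.sha, (p : ℤ) • x = 0 ∧ x ≠ 0) ∨ 2 ≤ padicValNat p W.tamagawaProduct) → MissingUpperBoundAt W p)
    (hCt : ∀ (W : WeierstrassCurve ℚ) [W.IsElliptic] [W.IsGloballyMinimal] (p : ℕ) [Fact p.Prime],
      ClassX11a W p → ¬ Surj W p → 5 ≤ p → ¬ W.HasSplitMultiplicativeReductionAtPrime p →
      2 ≤ padicValNat p W.tamagawaProduct → (∀ x : W.sha, (p : ℤ) • x = 0 → x = 0) →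
      (∀ t : ℚ, W.entireLFunction 1 / (W.realPeriodRat : ℂ) = (t : ℂ) → padicValRat p t ≠ 0) →
      MissingUpperBoundAt W p) :
    ∀ (W : WeierstrassCurve ℚ) [W.IsElliptic] [W.IsGloballyMinimal] (p : ℕ) [Fact p.Prime],
      ClassX11a W p → ¬ Surj W p → 5 ≤ p → 2 ≤ padicValNat p W.tamagawaProduct →
      (∀ x : W.sha, (p : ℤ) • x = 0 → x = 0) → MissingUpperBoundAt W p := by
  intro W _ _ p _ hX hns hp5 htam hSha
  by_cases hsp : W.HasSplitMultiplicativeReductionAtPrime p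
  · exact hCe W p hX hns hp5 hsp (Or.inr htam)
  by_cases hunit : ∃ t : ℚ, W.entireLFunction 1 / (W.realPeriodRat : ℂ) = (t : ℂ) ∧ padicValRat p t = 0
  · exact hU W p hX hns hp5 hsp hunit
  · exact hCt W p hX hns hp5 hsp htam hSha fun t ht h0 => hunit ⟨t, ht, h0⟩

/-- **C_Ш ∧ C_cc ⟹ C_exc♭ ∧ C_exp ∧ C_tam (fact-free weakening)** — each flat core is one of the two uniform cores on a sub-locus.  With §1 this shows rev 12 asks NO MORE of
the future than rev 11 (modulo the closed unit sector). [cite: Miller2011LMS, Def. 1.1 (arXiv:1010.2431 p. 3)] -/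
theorem threeFlatCores_of_twoCores
    (hC : ∀ (W : WeierstrassCurve ℚ) [W.IsElliptic] [W.IsGloballyMinimal] (p : ℕ) [Fact p.Prime],
      ClassX11a W p → ¬ Surj W p → 5 ≤ p → (∃ x : W.sha, (p : ℤ) • x = 0 ∧ x ≠ 0) → MissingUpperBoundAt W p)
    (hD : ∀ (W : WeierstrassCurve ℚ) [W.IsElliptic] [W.IsGloballyMinimal] (p : ℕ) [Fact p.Prime],
      ClassX11a W p → ¬ Surj W p → 5 ≤ p → 2 ≤ padicValNat p W.tamagawaProduct →
      (∀ x : W.sha, (p : ℤ) • x = 0 → x = 0) → MissingUpperBoundAt W p) :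
    (∀ (W : WeierstrassCurve ℚ) [W.IsElliptic] [W.IsGloballyMinimal] (p : ℕ) [Fact p.Prime],
        ClassX11a W p → ¬ Surj W p → 5 ≤ p → W.HasSplitMultiplicativeReductionAtPrime p →
        ((∃ x : W.sha, (p : ℤ) • x = 0 ∧ x ≠ 0) ∨ 2 ≤ padicValNat p W.tamagawaProduct) → MissingUpperBoundAt W p) ∧
      (∀ (W : WeierstrassCurve ℚ) [W.IsElliptic] [W.IsGloballyMinimal] (p : ℕ) [Fact p.Prime],
        ClassX11a W p → ¬ Surj W p → 5 ≤ p → ¬ W.HasSplitMultiplicativeReductionAtPrime p →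
        (∃ x : W.sha, (p : ℤ) • x = 0 ∧ x ≠ 0) →
        (∀ t : ℚ, W.entireLFunction 1 / (W.realPeriodRat : ℂ) = (t : ℂ) → padicValRat p t ≠ 0) →
        MissingUpperBoundAt W p) ∧
      (∀ (W : WeierstrassCurve ℚ) [W.IsElliptic] [W.IsGloballyMinimal] (p : ℕ) [Fact p.Prime],
        ClassX11a W p → ¬ Surj W p → 5 ≤ p → ¬ W.HasSplitMultiplicativeReductionAtPrime p →
        2 ≤ padicValNat p W.tamagawaProduct → (∀ x : W.sha, (p : ℤ) • x = 0 → x = 0) →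
        (∀ t : ℚ, W.entireLFunction 1 / (W.realPeriodRat : ℂ) = (t : ℂ) → padicValRat p t ≠ 0) →
        MissingUpperBoundAt W p) := by
  refine ⟨fun W _ _ p _ hX hns hp5 _ h => ?_, fun W _ _ p _ hX hns hp5 _ hSha _ => hC W p hX hns hp5 hSha,
    fun W _ _ p _ hX hns hp5 _ htam hSha _ => hD W p hX hns hp5 htam hSha⟩
  rcases h with hSha | htam
  · exact hC W p hX hns hp5 hSha
  · by_cases hSha : ∀ x : W.sha, (p : ℤ) • x = 0 → x = 0
    · exact hD W p hX hns hp5 htam hSha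
    · push Not at hSha
      exact hC W p hX hns hp5 hSha

/-! ## §2 Glue BY NAME (rev 12), the planner turnkey, exactness -/

/-- **Glue (fact-free; rev 12 of the record): UNIT → SHALLOW → EXC-SHALLOW → C_Ш → C_cc ⟹ U5 BY NAME** — the three flat cores of rev 11 are recovered from the two
uniform cores (`threeFlatCores_of_twoCores`) and the rev-11 glue `upperNonSurjFive_of_sectors_of_threeFlatCores` applies.
[cite: Miller2011LMS, Def. 1.1 (arXiv:1010.2431 p. 3)] [cite: SilvermanATAEC1994, Cor. IV.9.2 (d)] -/
theorem upperNonSurjFive_of_sectors_of_twoCores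
    (hU : ∀ (W : WeierstrassCurve ℚ) [W.IsElliptic] [W.IsGloballyMinimal] (p : ℕ) [Fact p.Prime],
      ClassX11a W p → ¬ Surj W p → 5 ≤ p → ¬ W.HasSplitMultiplicativeReductionAtPrime p →
      (∃ t : ℚ, W.entireLFunction 1 / (W.realPeriodRat : ℂ) = (t : ℂ) ∧ padicValRat p t = 0) →
      MissingUpperBoundAt W p)
    (hS : ∀ (W : WeierstrassCurve ℚ) [W.IsElliptic] [W.IsGloballyMinimal] (p : ℕ) [Fact p.Prime],
      ClassX11a W p → ¬ Surj W p → 5 ≤ p → ¬ W.HasSplitMultiplicativeReductionAtPrime p →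
      padicValNat p W.tamagawaProduct ≤ 1 → (∀ x : W.sha, (p : ℤ) • x = 0 → x = 0) → MissingUpperBoundAt W p)
    (hE : ∀ (W : WeierstrassCurve ℚ) [W.IsElliptic] [W.IsGloballyMinimal] (p : ℕ) [Fact p.Prime],
      ClassX11a W p → ¬ Surj W p → 5 ≤ p → W.HasSplitMultiplicativeReductionAtPrime p →
      padicValNat p W.tamagawaProduct ≤ 1 → (∀ x : W.sha, (p : ℤ) • x = 0 → x = 0) → MissingUpperBoundAt W p)
    (hC : ∀ (W : WeierstrassCurve ℚ) [W.IsElliptic] [W.IsGloballyMinimal] (p : ℕ) [Fact p.Prime],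
      ClassX11a W p → ¬ Surj W p → 5 ≤ p → (∃ x : W.sha, (p : ℤ) • x = 0 ∧ x ≠ 0) → MissingUpperBoundAt W p)
    (hD : ∀ (W : WeierstrassCurve ℚ) [W.IsElliptic] [W.IsGloballyMinimal] (p : ℕ) [Fact p.Prime],
      ClassX11a W p → ¬ Surj W p → 5 ≤ p → 2 ≤ padicValNat p W.tamagawaProduct →
      (∀ x : W.sha, (p : ℤ) • x = 0 → x = 0) → MissingUpperBoundAt W p) :
    PrintX11a.UpperNonSurjFive :=
  upperNonSurjFive_of_sectors_of_threeFlatCores hU hS hE (threeFlatCores_of_twoCores hC hD).1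
    (threeFlatCores_of_twoCores hC hD).2.1 (threeFlatCores_of_twoCores hC hD).2.2

/-- **PLANNER TURNKEY (CONDITIONAL on eleven named facts): the facts + the two uniform cores ⟹ U5 BY NAME** — UNIT from `upperNonSurjFive_on_unitSector_of_eightFacts`
(p671927), SHALLOW from `upperNonSurjFive_on_shallowSector_of_nineFacts` (p677281), EXC-SHALLOW from `Exc.upperNonSurjFive_on_excShallowSector_of_facts` (p686445).
Facts: Stein–Wuthrich 6.1 ×2, Kato 12.4, modularity, Kato §17.13 V′/VI′/XI′, Mazur 1978 Cor. 4.1, GZK, Coleman–Edixhoven 1998 Thm. 2.1, Greenberg–Vatsal 2000 §3, Ribet 1984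
Thm. 4.1 (Ihara), and `ribet1990_levelLowering_gamma0_newform_general_of_five_le` (Darmon–Diamond–Taylor Thm. 3.15 at `p ≥ 5`).
[cite: Kato2004Asterisque, §17.13 (pp. 279–280)] [cite: DarmonDiamondTaylor1995, Thm. 3.15] [cite: GreenbergVatsal2000, §3 (17)–(19)] [cite: Miller2011LMS, Def. 1.1] -/
theorem upperNonSurjFive_of_elevenFacts_of_twoCores
    (hJs : thm61_splitMultiplicative) (hJn : thm61_nonsplitMultiplicative)
    (h12 : Kato2004.thm12_4) (hnf : exists_isNewformOf)
    (hns' : Kato2004.exists_multDivisibilityInputs_nonsplit_contra)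
    (hsp' : Kato2004.exists_multDivisibilityInputs_split_contra)
    (hfine' : Kato2004.exists_multDivisibilityInputs_fine_contra) (hMz : mazur_not_dvd_maninConstant_of_odd)
    (hGZK : rank_eq_analyticRank_of_analyticRank_le_one)
    (hCE : colemanEdixhoven1998_heckePolynomial_simpleRoots)
    (hGV : greenbergVatsal2000_plusSymbol_congruence) (hI : ribet1984_iharaLemma)
    (hLL : ribet1990_levelLowering_gamma0_newform_general_of_five_le)
    (hC : ∀ (W : WeierstrassCurve ℚ) [W.IsElliptic] [W.IsGloballyMinimal] (p : ℕ) [Fact p.Prime],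
      ClassX11a W p → ¬ Surj W p → 5 ≤ p → (∃ x : W.sha, (p : ℤ) • x = 0 ∧ x ≠ 0) → MissingUpperBoundAt W p)
    (hD : ∀ (W : WeierstrassCurve ℚ) [W.IsElliptic] [W.IsGloballyMinimal] (p : ℕ) [Fact p.Prime],
      ClassX11a W p → ¬ Surj W p → 5 ≤ p → 2 ≤ padicValNat p W.tamagawaProduct →
      (∀ x : W.sha, (p : ℤ) • x = 0 → x = 0) → MissingUpperBoundAt W p) :
    PrintX11a.UpperNonSurjFive :=
  upperNonSurjFive_of_sectors_of_twoCores
    (upperNonSurjFive_on_unitSector_of_eightFacts hJs hJn h12 hnf hns' hsp' hfine' hMz)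
    (upperNonSurjFive_on_shallowSector_of_nineFacts hJs hJn h12 hnf hns' hsp' hfine' hMz hGZK)
    (Exc.upperNonSurjFive_on_excShallowSector_of_facts hCE hGV hI hMz hnf hLL hGZK) hC hD

/-- **Exactness of the rev-12 cut (fact-free):** U5 ⟺ UNIT ∧ SHALLOW ∧ EXC-SHALLOW ∧ C_Ш ∧ C_cc — each piece is U5 on a sub-locus, and together they give U5
(`upperNonSurjFive_of_sectors_of_twoCores`). [cite: Miller2011LMS, Def. 1.1 (arXiv:1010.2431 p. 3)] -/
theorem upperNonSurjFive_iff_sectors_and_twoCores :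
    PrintX11a.UpperNonSurjFive ↔
      ((∀ (W : WeierstrassCurve ℚ) [W.IsElliptic] [W.IsGloballyMinimal] (p : ℕ) [Fact p.Prime],
          ClassX11a W p → ¬ Surj W p → 5 ≤ p → ¬ W.HasSplitMultiplicativeReductionAtPrime p →
          (∃ t : ℚ, W.entireLFunction 1 / (W.realPeriodRat : ℂ) = (t : ℂ) ∧ padicValRat p t = 0) →
          MissingUpperBoundAt W p) ∧
        (∀ (W : WeierstrassCurve ℚ) [W.IsElliptic] [W.IsGloballyMinimal] (p : ℕ) [Fact p.Prime],
          ClassX11a W p → ¬ Surj W p → 5 ≤ p → ¬ W.HasSplitMultiplicativeReductionAtPrime p →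
          padicValNat p W.tamagawaProduct ≤ 1 → (∀ x : W.sha, (p : ℤ) • x = 0 → x = 0) → MissingUpperBoundAt W p) ∧
        (∀ (W : WeierstrassCurve ℚ) [W.IsElliptic] [W.IsGloballyMinimal] (p : ℕ) [Fact p.Prime],
          ClassX11a W p → ¬ Surj W p → 5 ≤ p → W.HasSplitMultiplicativeReductionAtPrime p →
          padicValNat p W.tamagawaProduct ≤ 1 → (∀ x : W.sha, (p : ℤ) • x = 0 → x = 0) → MissingUpperBoundAt W p) ∧
        (∀ (W : WeierstrassCurve ℚ) [W.IsElliptic] [W.IsGloballyMinimal] (p : ℕ) [Fact p.Prime],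
          ClassX11a W p → ¬ Surj W p → 5 ≤ p → (∃ x : W.sha, (p : ℤ) • x = 0 ∧ x ≠ 0) → MissingUpperBoundAt W p) ∧
        (∀ (W : WeierstrassCurve ℚ) [W.IsElliptic] [W.IsGloballyMinimal] (p : ℕ) [Fact p.Prime],
          ClassX11a W p → ¬ Surj W p → 5 ≤ p → 2 ≤ padicValNat p W.tamagawaProduct →
          (∀ x : W.sha, (p : ℤ) • x = 0 → x = 0) → MissingUpperBoundAt W p)) :=
  ⟨fun h => ⟨fun W _ _ p _ hX hns hp5 _ _ => h W p hX hns hp5, fun W _ _ p _ hX hns hp5 _ _ _ => h W p hX hns hp5,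
      fun W _ _ p _ hX hns hp5 _ _ _ => h W p hX hns hp5, fun W _ _ p _ hX hns hp5 _ => h W p hX hns hp5,
      fun W _ _ p _ hX hns hp5 _ _ => h W p hX hns hp5⟩,
    fun h => upperNonSurjFive_of_sectors_of_twoCores h.1 h.2.1 h.2.2.1 h.2.2.2.1 h.2.2.2.2⟩

end Summit.BirchSwinnertonDyer.BirchSwinnertonDyer.Theorems.GL1Cartan

end
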